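import Summits.KontsevichZagierPeriods.KontsevichZagierPeriods.Theses.HermiteRigidity
import Summits.KontsevichZagierPeriods.KontsevichZagierPeriods.Theorems.ReducedPeriodRing.Negative.Certificates
import Literature.NumberTheory.Transcendental.KZRulesAssociator

/-!
# Sketch — crux-ideate (round 1, ideator 2) for `HermiteRigidity.RealEllipticSectorKernel`
(stmt-KontsevichZagierPeriods-10632)

First lemmas of the two idea cards, stated over existing declarations:

* card `mirror-glue-sector-direct-sum`: `sectorDirectSum` (PROVED here, pure algebra over
  `KZ.FormalRep`), `mirror_domain` (PROVED: the `f < 0` interval of `(q₂, q₃)` is minus the oval of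
  `(q₂, −q₃)`, by pure logic), `mirror_generator` (signature: one rule-2 move `x ↦ −x`);
* card `duplication-descent-integer-division`: `integerDivision` (PROVED here from the tree's
  `ReducedPeriodRingNegative.nsmul_bijective` + `KZ.toFormalPeriod_eq_zero_iff`), the exact
  duplication identities `dup_numerator_sub_root`, `dup_wronskian` (PROVED, `ring`), and the
  signatures `duplication_half_transfer` (rule 2 along the ℚ-rational duplication map on a half
  oval) and `integer_normal_form` (ℤ⁴ normal form after clearing Hermite denominators), plus
  `kernel_of_integer_normal_form` (PROVED: how the ℤ⁴ normal form + integer division close the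
  kernel step).
-/

namespace Summit.KontsevichZagierPeriods.KontsevichZagierPeriods.Cruxes.RealEllipticSectorKernel.SketchIdeator2

open Literature.NumberTheory.Transcendental

/-! ## Card A — mirror + sector direct sum -/

/-- **Sector direct sum.** Kernel statements of two sectors whose values live in additive subgroups
`V`, `W ⊆ ℝ` with `V ∩ W = 0` glue to the kernel statement of the union. [folklore] -/
theorem sectorDirectSum (S T : Set KZ.FormalRep) (V W : AddSubgroup ℝ)
    (hS : ∀ c ∈ AddSubgroup.closure S, KZ.eval c = 0 → c ∈ KZ.relations)
    (hT : ∀ c ∈ AddSubgroup.closure T, KZ.eval c = 0 → c ∈ KZ.relations)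
    (hSV : ∀ s ∈ S, KZ.eval s ∈ V) (hTW : ∀ t ∈ T, KZ.eval t ∈ W)
    (hVW : ∀ v : ℝ, v ∈ V → v ∈ W → v = 0) :
    ∀ c ∈ AddSubgroup.closure (S ∪ T), KZ.eval c = 0 → c ∈ KZ.relations := by
  intro c hc h0
  rw [AddSubgroup.closure_union] at hc
  obtain ⟨a, ha, b, hb, rfl⟩ := AddSubgroup.mem_sup.mp hc
  have haV : KZ.eval a ∈ V := by
    have hle : AddSubgroup.closure S ≤ V.comap KZ.eval :=
      (AddSubgroup.closure_le _).mpr fun s hs => hSV s hs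
    exact hle ha
  have hbW : KZ.eval b ∈ W := by
    have hle : AddSubgroup.closure T ≤ W.comap KZ.eval :=
      (AddSubgroup.closure_le _).mpr fun t ht => hTW t ht
    exact hle hb
  have hab : KZ.eval a + KZ.eval b = 0 := by rw [← map_add]; exact h0
  have ha0 : KZ.eval a = 0 := by
    refine hVW _ haV ?_
    have : KZ.eval a = -KZ.eval b := eq_neg_of_add_eq_zero_left hab
    rw [this]
    exact W.neg_mem hbW
  have hb0 : KZ.eval b = 0 := by rw [ha0, zero_add] at hab; exact hab
  exact KZ.relations.add_mem (hS a ha ha0) (hT b hb hb0)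

/-- **Mirror, set level.** The `f < 0` interval `σ′ = (e₂, e₁)` of `f = 4x³ − q₂x − q₃` is exactly
minus the bounded oval `σ̃ = (−e₁, −e₂)` of the mirror cubic `f̃(u) = 4u³ − q₂u + q₃ = −f(−u)`
(invariants `(q₂, −q₃)`, same discriminant) — by pure logic, no root analysis. [folklore] -/
theorem mirror_domain (q₂ q₃ : ℚ) (p : Fin 1 → ℝ) :
    (p ∈ {p : Fin 1 → ℝ | 4 * p 0 ^ 3 - (q₂ : ℝ) * p 0 - (q₃ : ℝ) < 0 ∧
        ∃ t : ℝ, t < p 0 ∧ 0 < 4 * t ^ 3 - (q₂ : ℝ) * t - (q₃ : ℝ)}) ↔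
      ((-p) ∈ {p : Fin 1 → ℝ | 0 < 4 * p 0 ^ 3 - (q₂ : ℝ) * p 0 - ((-q₃ : ℚ) : ℝ) ∧
        ∃ t : ℝ, p 0 < t ∧ 4 * t ^ 3 - (q₂ : ℝ) * t - ((-q₃ : ℚ) : ℝ) < 0}) := by
  simp only [Set.mem_setOf_eq, Pi.neg_apply, Rat.cast_neg]
  constructor
  · rintro ⟨h1, t, ht, h2⟩
    refine ⟨by nlinarith [h1], -t, by linarith, by nlinarith [h2]⟩
  · rintro ⟨h1, t, ht, h2⟩
    refine ⟨by nlinarith [h1], -t, by linarith, by nlinarith [h2]⟩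

/-- **Mirror, move level (signature).** A generator `[σ′, x^m/√(−f)]` of the crux's second family is,
by ONE change-of-variables move `u = −x` (`|det| = 1`), `(−1)^m` times a generator
`[σ̃, u^m/√f̃]` of the FIRST family of the mirror curve `(q₂, −q₃)`. [folklore] -/
theorem mirror_generator (q₂ q₃ : ℚ) (m : ℕ) (r : KZ.IntegralRep 1) :
    let f : ℝ → ℝ := fun x => 4 * x ^ 3 - (q₂ : ℝ) * x - (q₃ : ℝ)
    let fm : ℝ → ℝ := fun x => 4 * x ^ 3 - (q₂ : ℝ) * x - ((-q₃ : ℚ) : ℝ)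
    let σ' : Set (Fin 1 → ℝ) := {p | f (p 0) < 0 ∧ ∃ t : ℝ, t < p 0 ∧ 0 < f t}
    let σm : Set (Fin 1 → ℝ) := {p | 0 < fm (p 0) ∧ ∃ t : ℝ, p 0 < t ∧ fm t < 0}
    r.domain = σ' → Set.EqOn r.integrand (fun p => p 0 ^ m / Real.sqrt (-f (p 0))) σ' →
    ∃ r' : KZ.IntegralRep 1, r'.domain = σm ∧
      Set.EqOn r'.integrand (fun p => p 0 ^ m / Real.sqrt (fm (p 0))) σm ∧
      KZ.of r - ((-1 : ℤ) ^ m) • KZ.of r' ∈ KZ.relations := by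
  sorry

/-! ## Card B — integer division + duplication descent -/

/-- **Integer division is a derived rule** (items FurushoPentagon.IntegerDivision /
CoactionDevissage.TorsionFree), available NOW from the tree: `P = FormalRep ⧸ relations` is
uniquely divisible (`ReducedPeriodRingNegative.nsmul_bijective`). [folklore] -/
theorem integerDivision (c : KZ.FormalRep) {N : ℕ} (hN : 0 < N) (h : N • c ∈ KZ.relations) :
    c ∈ KZ.relations := by
  rw [← KZ.toFormalPeriod_eq_zero_iff] at h ⊢
  rw [map_nsmul] at h
  have hinj :=
    (Summit.KontsevichZagierPeriods.KontsevichZagierPeriods.ReducedPeriodRingNegative.nsmul_bijective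
      hN).1
  exact hinj (show N • KZ.toFormalPeriod c = N • (0 : KZ.FormalPeriodRing) by rw [smul_zero]; exact h)

/-- **Duplication identity I** (exact, checked by `ring`): with `f = 4(x−e₁)(x−e₂)(x−e₃)`,
`e₁+e₂+e₃ = 0`, `N = x⁴ + q₂x²/2 + 2q₃x + q₂²/16` the numerator of `x(2P)`:
`N − e₁ f = ((x−e₁)² − (e₁−e₂)(e₁−e₃))²`, so `ψ = N/f ≥ e₁` on `{f > 0}` with a double root at the
4-torsion abscissa. [folklore] -/
theorem dup_numerator_sub_root (e₁ e₂ e₃ q₂ q₃ x : ℝ) (h₃ : e₃ = -e₁ - e₂)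
    (hq₂ : q₂ = -4 * (e₁ * e₂ + e₂ * e₃ + e₃ * e₁)) (hq₃ : q₃ = 4 * (e₁ * e₂ * e₃)) :
    (x ^ 4 + q₂ / 2 * x ^ 2 + 2 * q₃ * x + q₂ ^ 2 / 16) - e₁ * (4 * x ^ 3 - q₂ * x - q₃)
      = ((x - e₁) ^ 2 - (e₁ - e₂) * (e₁ - e₃)) ^ 2 := by
  subst hq₂ hq₃
  subst h₃
  ring

/-- **Duplication identity II** (exact, checked by `ring`): the Wronskian `D = N′f − Nf′` (so that
`ψ′ = D/f²`) factors as `4 g₁ g₂ g₃`, `gᵢ = (x−eᵢ)² − (eᵢ−eⱼ)(eᵢ−eₖ)`; with I this gives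
`ψ′² f = 4 f(ψ)`, i.e. the rule-2 weight `|ψ′|/√f(ψ) = 2/√f`. [folklore] -/
theorem dup_wronskian (e₁ e₂ e₃ q₂ q₃ x : ℝ) (h₃ : e₃ = -e₁ - e₂)
    (hq₂ : q₂ = -4 * (e₁ * e₂ + e₂ * e₃ + e₃ * e₁)) (hq₃ : q₃ = 4 * (e₁ * e₂ * e₃)) :
    (4 * x ^ 3 + q₂ * x + 2 * q₃) * (4 * x ^ 3 - q₂ * x - q₃)
        - (x ^ 4 + q₂ / 2 * x ^ 2 + 2 * q₃ * x + q₂ ^ 2 / 16) * (12 * x ^ 2 - q₂)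
      = 4 * (((x - e₁) ^ 2 - (e₁ - e₂) * (e₁ - e₃)) * (((x - e₂) ^ 2 - (e₂ - e₁) * (e₂ - e₃)) *
          ((x - e₃) ^ 2 - (e₃ - e₁) * (e₃ - e₂)))) := by
  subst hq₂ hq₃
  subst h₃
  ring

/-- **Duplication descent, move level (signature).** On each half of the oval cut at the fold of
the ℚ-RATIONAL duplication map `ψ = N/f` (the halves are the ℚ-semialgebraic sets
`{x ∈ σ | ±D(x) > 0}`), `[half, 2/√f] − [σ″, 1/√f]` is ONE change-of-variables instance along `ψ`
(injective on the half, image `σ″ = (e₁, ∞)`, weight `|ψ′|/√f(ψ) = 2/√f`), with no algebraic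
irrational datum in the move. [folklore] -/
theorem duplication_half_transfer (q₂ q₃ : ℚ) (hΔ : 0 < (q₂ : ℝ) ^ 3 - 27 * (q₃ : ℝ) ^ 2) :
    let f : ℝ → ℝ := fun x => 4 * x ^ 3 - (q₂ : ℝ) * x - (q₃ : ℝ)
    let N : ℝ → ℝ := fun x => x ^ 4 + (q₂ : ℝ) / 2 * x ^ 2 + 2 * (q₃ : ℝ) * x + (q₂ : ℝ) ^ 2 / 16
    let D : ℝ → ℝ := fun x =>
      (4 * x ^ 3 + (q₂ : ℝ) * x + 2 * (q₃ : ℝ)) * f x - N x * (12 * x ^ 2 - (q₂ : ℝ))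
    let σ : Set (Fin 1 → ℝ) := {p | 0 < f (p 0) ∧ ∃ t : ℝ, p 0 < t ∧ f t < 0}
    let σ'' : Set (Fin 1 → ℝ) := {p | 0 < f (p 0) ∧ ∀ t : ℝ, p 0 < t → 0 < f t}
    ∀ (s : ℝ), (s = 1 ∨ s = -1) → ∀ (r r'' : KZ.IntegralRep 1),
      r.domain = {p | p ∈ σ ∧ 0 < s * D (p 0)} →
      Set.EqOn r.integrand (fun p => 2 / Real.sqrt (f (p 0))) r.domain →
      r''.domain = σ'' → Set.EqOn r''.integrand (fun p => 1 / Real.sqrt (f (p 0))) σ'' →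
      KZ.of r - KZ.of r'' ∈ KZ.changeOfVariablesRel := by
  sorry

/-- **ℤ⁴ normal form (signature).** Clearing the (rational) Hermite denominators: every element of
the crux's sector `closure S`, multiplied by a positive integer, is congruent modulo relations to an
INTEGER combination of four fixed basis representations `b₀ = [σ,1/√f]`, `b₁ = [σ,x/√f]`,
`b₂ = [σ′,1/√(−f)]`, `b₃ = [σ′,x/√(−f)]`; so "value 0 ⇒ relation" is "ℚ-independent values ⇒ zero
vector", then `integerDivision`. [folklore] -/
theorem integer_normal_form (q₂ q₃ : ℚ) (hΔ : 0 < (q₂ : ℝ) ^ 3 - 27 * (q₃ : ℝ) ^ 2) :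
    let f : ℝ → ℝ := fun x => 4 * x ^ 3 - (q₂ : ℝ) * x - (q₃ : ℝ)
    let σ : Set (Fin 1 → ℝ) := {p | 0 < f (p 0) ∧ ∃ t : ℝ, p 0 < t ∧ f t < 0}
    let σ' : Set (Fin 1 → ℝ) := {p | f (p 0) < 0 ∧ ∃ t : ℝ, t < p 0 ∧ 0 < f t}
    let σ'' : Set (Fin 1 → ℝ) := {p | 0 < f (p 0) ∧ ∀ t : ℝ, p 0 < t → 0 < f t}
    let S : Set KZ.FormalRep :=
      {c | ∃ (r : KZ.IntegralRep 1) (m : ℕ), r.domain = σ ∧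
          Set.EqOn r.integrand (fun p => p 0 ^ m / Real.sqrt (f (p 0))) σ ∧ c = KZ.of r} ∪
      {c | ∃ (r : KZ.IntegralRep 1) (m : ℕ), r.domain = σ' ∧
          Set.EqOn r.integrand (fun p => p 0 ^ m / Real.sqrt (- f (p 0))) σ' ∧ c = KZ.of r} ∪
      {c | ∃ (r : KZ.IntegralRep 1), r.domain = σ'' ∧
          Set.EqOn r.integrand (fun p => 1 / Real.sqrt (f (p 0))) σ'' ∧ c = KZ.of r}
    ∀ (b₀ b₁ b₂ b₃ : KZ.IntegralRep 1),
      b₀.domain = σ → Set.EqOn b₀.integrand (fun p => 1 / Real.sqrt (f (p 0))) σ →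
      b₁.domain = σ → Set.EqOn b₁.integrand (fun p => p 0 / Real.sqrt (f (p 0))) σ →
      b₂.domain = σ' → Set.EqOn b₂.integrand (fun p => 1 / Real.sqrt (- f (p 0))) σ' →
      b₃.domain = σ' → Set.EqOn b₃.integrand (fun p => p 0 / Real.sqrt (- f (p 0))) σ' →
      ∀ c ∈ AddSubgroup.closure S, ∃ (L : ℕ) (a₀ a₁ a₂ a₃ : ℤ), 0 < L ∧
        L • c - (a₀ • KZ.of b₀ + a₁ • KZ.of b₁ + a₂ • KZ.of b₂ + a₃ • KZ.of b₃) ∈ KZ.relations := by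
  sorry

/-- **How card B closes the crux from the ℤ⁴ normal form** (PROVED): if
`L • c ≡ a₀b₀ + a₁b₁ + a₂b₂ + a₃b₃` modulo relations and `eval c = 0`, the ℚ-linear independence of
the four basis values forces `aᵢ = 0` (soundness `KZ.relations_le_ker_eval_holds`), so
`L • c ∈ relations` and integer division gives `c ∈ relations`. [folklore] -/
theorem kernel_of_integer_normal_form (c : KZ.FormalRep) (b₀ b₁ b₂ b₃ : KZ.FormalRep)
    (hind : ∀ a₀ a₁ a₂ a₃ : ℤ,
      (a₀ : ℝ) * KZ.eval b₀ + a₁ * KZ.eval b₁ + a₂ * KZ.eval b₂ + a₃ * KZ.eval b₃ = 0 →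
        a₀ = 0 ∧ a₁ = 0 ∧ a₂ = 0 ∧ a₃ = 0)
    {L : ℕ} (hL : 0 < L) {a₀ a₁ a₂ a₃ : ℤ}
    (hnf : L • c - (a₀ • b₀ + a₁ • b₁ + a₂ • b₂ + a₃ • b₃) ∈ KZ.relations)
    (h0 : KZ.eval c = 0) : c ∈ KZ.relations := by
  have hsound : KZ.eval (L • c - (a₀ • b₀ + a₁ • b₁ + a₂ • b₂ + a₃ • b₃)) = 0 :=
    (AddMonoidHom.mem_ker).1 (KZ.relations_le_ker_eval_holds hnf)
  have hlin : (a₀ : ℝ) * KZ.eval b₀ + a₁ * KZ.eval b₁ + a₂ * KZ.eval b₂ + a₃ * KZ.eval b₃ = 0 := by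
    simp only [map_sub, map_nsmul, map_add, map_zsmul, h0, smul_zero, zero_sub, neg_eq_zero,
      zsmul_eq_mul] at hsound
    linarith
  obtain ⟨r0, r1, r2, r3⟩ := hind a₀ a₁ a₂ a₃ hlin
  subst r0 r1 r2 r3
  simp only [zero_smul, add_zero, sub_zero] at hnf
  exact integerDivision c hL hnf

end Summit.KontsevichZagierPeriods.KontsevichZagierPeriods.Cruxes.RealEllipticSectorKernel.SketchIdeator2
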